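import Literature.NumberTheory.EllipticCurves.KellerYin2024.MultiplicativeHeegnerPointMainConjecture
import Literature.NumberTheory.EllipticCurves.Castella2024.MultiplicativeHeegnerPointMainConjecture
import Literature.NumberTheory.EllipticCurves.Castella2024.LambdaAdicHeegnerClassExistence
import Literature.NumberTheory.EllipticCurves.CompactSelmerKummerDescent
import Literature.NumberTheory.EllipticCurves.IwasawaAlgebraRankOneIdealProofs
import Literature.NumberTheory.EllipticCurves.IwasawaAlgebraCharIdealProofs
import Literature.NumberTheory.EllipticCurves.CyclotomicIwasawaMainTheoremIrreducibleProofs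
import HarnessLib

/-!
# Rescaling a Heegner family by an integer, and what the `∀ (F : HeegnerFamily …)` layout of the
# integral Heegner-point-main-conjecture binders then forces (PROOFS ONLY — no named fact)

ARM P (cell `bsd-cited`, reader `bsd-cited-r19` g4, D-AUDIT-r19 ADDENDUM-5 §4, sha16
`6a0e68f1a5f0faa2`). PURPOSE: a kernel demonstration, by name, of the LAYOUT finding recorded in
that sheet. Print (Castella arXiv:2409.01360 l.268 "Upon the choice of a modular parametrization
`X_0(N) → E` … which we fix from now on"; Castella–Grossi–Skinner, Math. Ann. 393 (2025) l.452–455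
"Heegner points on `E` associated with a given modular parametrization `π`"; Keller–Yin
arXiv:2402.12781v2 Thm 5.2.1, L1783–1792) fixes ONE parametrisation and states an INTEGRAL equality
`char_Λ(𝒳_tors) = char_Λ(𝔖/Λ𝐳_∞)²`. The tree's binders quantify over ALL
`F : HeegnerFamily N W K κ jbar`, and a Heegner family carries its own parametrisation datum
`F.Dt : ModularParametrizationData W N`, pinned only by `c Λ_f ⊆ Λ_E` — so with a parametrisation
`φ` every rescaling `m • φ` (`c ↦ m c`, `deg ↦ m² deg`) is again a datum. This file PROVES:

* §1 `WeierstrassCurve.padicPi_intCast`: the constant `m ∈ ℤ ⊂ ℤ_p` acts on `∏_k H¹(H, E[p^k])` as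
  `m • ·` (the components are `p^k`-torsion).
* §2 `IsHeegnerGeomPoint.zsmul`, `IsHeegnerNormPoint.zsmul`, `HeegnerFamily.zsmul`: given a family
  `F` and ANY datum `Dt'` whose parametrisation is `m •` that of `F` (`hφ : ∀ τ, Dt'.φ τ = m • F.Dt.φ τ`),
  the rescaled Heegner family `F.zsmul Dt' m hφ` (same orientation; `y ↦ m • y`, `z_j ↦ m • z_j`) —
  Heegner points and their norms are additive in the parametrisation (`complexPoint`, `uniformize`
  are group homomorphisms; the Galois action commutes with `m •`). The datum `Dt'` itself is NOT
  constructed here: its field `deg_spec` for `m • φ` needs the `Γ₀(N)`-invariance of `φ`, which the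
  tree keeps as the named fact `ModularParametrizationData.φ_eq_of_mk_eq_mk`; it is taken as an INPUT.
* §3 `Castella2024.IsLambdaAdicHeegnerClass.zsmul`: the `Λ`-adic Heegner class of the rescaled family
  is `(C m) • z` (Bertolini–Darmon's regularized classes are Kummer images; Kummer families are
  additive, `IsKummerFamilyOver.zsmul`; `T`-constants act through `padicPi`, `LambdaAdicSelmerData.proj_C`).
* §4 `Module.charIdeal_quotient_span_smul_eq`: for a finitely generated `Λ`-module `S`, a
  torsion-free `z ∈ S` with `S/Λz` torsion and `a ≠ 0`: `char(S/Λ(a•z)) = (a) · char(S/Λz)`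
  (multiplicativity `Module.charIdeal_eq_mul_of_exact` on `0 → Λ/(a) → S/Λaz → S/Λz → 0`,
  `char(Λ/(a)) = (a)`); `Ideal.eq_bot_of_sq_eq_span_mul_sq`: in the local Noetherian domain `Λ`,
  `I² = ((a)·I)²` with `a` a non-unit forces `I = ⊥` (Nakayama).
* §5 THE CONSEQUENCE, BY NAME, for `KellerYin2024.thm521_multHg_charIdeal_torsion_eq_sq_OPEN`
  (KY arXiv:2402.12781v2 Thm 5.2.1, typed p464919): `charIdealSq_eq_of_thm521_OPEN_zsmul` — the binder
  equates `char(𝔖/Λz)²` with `char(𝔖/Λ(C m • z))²` for the class `z` of `F` and EVERY rescaling datum;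
  and `false_of_thm521_OPEN_zsmul` — with `m = p`, a torsion-free class `z` and `𝔖/Λz` torsion
  (print's "rank one, `𝐳_∞` non-torsion") the binder yields `False`. I.e. AS A HYPOTHESIS the typed
  `∀ F`-integral-equality is inconsistent with the existence of one non-degenerate rescalable
  witness; print's one-parametrisation statement is not touched. §6 repeats the two lines verbatim
  for the identically laid-out `Castella2024.thm13_charIdeal_torsion_eq_sq_OPEN` (Castella
  arXiv:2409.01360 Thm 1.3, the `E[p]`-irreducible sibling). For the binders whose Heegner side is
  the Heegner MODULE (`heegnerCharIdeal D F`: `KellerYin2024.thmB_…_OPEN`,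
  `CastellaGrossiSkinner2025.thmC_…` (registry A141), …; D-AUDIT-r19 ADDENDUM-5 §4.3) the sheet's
  kernel K4 records the forced `F`-independence `heegnerCharIdeal D F ^ 2 = heegnerCharIdeal D F' ^ 2`
  by name; the module identity `heegnerModule D (F.zsmul …) = (C m) • heegnerModule D F` (a
  closure/limit object) is NOT proved here. The repair is to pin the parametrisation (a
  minimal-degree predicate on `F.Dt`) or to state the equality in `Λ ⊗ ℚ_p`
  (Castella–Grossi–Lee–Skinner, Invent. Math. 227 (2022), Remark after Conj. A, TeX L281–283: "the
  integral version … terms … are in general not invariant under isogenies. (With `p` inverted … the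
  terms are invariant …)").

* §6 the same two theorems for `Castella2024.thm13_charIdeal_torsion_eq_sq_OPEN`
  (`charIdealSq_eq_of_thm13_OPEN_zsmul`, `false_of_thm13_OPEN_zsmul`).

HONEST FRAMING: nothing here is a theorem about elliptic curves beyond bookkeeping; no new `Prop` is
named; `#print axioms` of every declaration is the standard trio. The existence of a rescaling datum
`Dt'` (hence of the witness) is an explicit hypothesis of §5, discharged in print by the sentence
"fix a modular parametrization" read twice (for `π` and `[p] ∘ π`).

## References
* [KellerYin2024] arXiv:2402.12781v2 Thm 5.2.1 (TeX L1783–L1792); [Castella2024] arXiv:2409.01360 §1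
  l.268, Thm 1.3, §2.2 (2.2)–(2.3); [CastellaGrossiSkinner2025] Math. Ann. 393 (2025) §1 (TeX l.452–455,
  l.476–483); [CastellaGrossiLeeSkinner2022] Invent. Math. 227 (2022) Intro (TeX L218, L281–283);
  [BertoliniDarmon1996] Invent. Math. 126 (1996) §2.5 (7)–(8), Prop. 2.7; [NeukirchSchmidtWingberg2008]
  Ch. V §3.
-/

set_option autoImplicit false

noncomputable section

open scoped Classical

open WeierstrassCurve Literature.NumberTheory.EllipticCurves
  Literature.NumberTheory.EllipticCurves.ModularForms
  Literature.NumberTheory.EllipticCurves.Castella2024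
  Literature.NumberTheory.EllipticCurves.KellerYin2024

universe u

/-! ## §1 Integer constants act on `∏_k H¹(H, E[p^k])` by integer multiplication -/

namespace WeierstrassCurve

variable {K : Type u} [Field K] (W : WeierstrassCurve K) (p : ℕ) [Fact p.Prime]
  (H : Subgroup (Field.absoluteGaloisGroup K))

/-- **`(m : ℤ_p) · y = m • y` on `∏_k H¹(H, E[p^k])`**: the `k`-th component is `p^k`-torsion
(`pow_smul_torsionH1Over_eq_zero`) and `(m mod p^k) ≡ m`. [cite: PerrinRiou1987BSMF, §0 p. 401 (the `ℤ_p`-module structure of `S_p(L)`)] -/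
theorem padicPi_intCast (m : ℤ) (y : W.torsionH1Pi p H) : W.padicPi p H (m : ℤ_[p]) y = m • y := by
  funext k
  haveI : NeZero (p ^ k) := ⟨pow_ne_zero _ (Fact.out : p.Prime).ne_zero⟩
  rw [padicPi_apply, Pi.smul_apply, map_intCast, ZMod.val_intCast]
  have hpk : (((p ^ k : ℕ) : ℤ)) • y k = 0 := by
    rw [Nat.cast_pow]
    exact W.pow_smul_torsionH1Over_eq_zero H p k (y k)
  rw [Int.emod_def, sub_zsmul, mul_comm, mul_zsmul, hpk]
  simp only [zsmul_zero, neg_zero, add_zero]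

end WeierstrassCurve

/-! ## §2 Rescaling Heegner points, norm points and Heegner families -/

namespace Literature.NumberTheory.EllipticCurves

variable {K : Type u} [Field K] [NumberField K] {N : ℕ} [NeZero N] {W : WeierstrassCurve ℚ}
  {p : ℕ} [Fact p.Prime] {κ : ZpExtension K p} {jbar : AlgebraicClosure K →+* ℂ}

/-- **A Heegner point rescales with the parametrisation**: if `Dt'.φ = m • Dt.φ` then `m • x` is the
Heegner point of the same form `Q` for `Dt'` (`complexPoint` is additive). [cite: GrossLMS1991, §3 (Heegner points as images of CM points under the parametrisation)] -/
theorem IsHeegnerGeomPoint.zsmul {Dt Dt' : ModularParametrizationData W N} (m : ℤ)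
    (hφ : ∀ τ, Dt'.φ τ = m • Dt.φ τ) {β : ℤ} {c : ℕ} {x : geomPoints (W.baseChange K)}
    (h : IsHeegnerGeomPoint N W K Dt β c jbar x) :
    IsHeegnerGeomPoint N W K Dt' β c jbar (m • x) := by
  obtain ⟨Q, hQ, hB, hx⟩ := h
  exact ⟨Q, hQ, hB, by rw [map_zsmul, hx, hφ]⟩

/-- **Norm points rescale**: `m • Norm_{K_n K[c]/K_n} P[c]` is the norm point of `m • P[c]` for the
rescaled datum (same transversal; the Galois action commutes with `m •`). [cite: Howard2004HeegnerKolyvagin, §3.3 (the norm points `Norm P[c]`)] -/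
theorem IsHeegnerNormPoint.zsmul {Dt Dt' : ModularParametrizationData W N} (m : ℤ)
    (hφ : ∀ τ, Dt'.φ τ = m • Dt.φ τ) {β : ℤ} {n c : ℕ} {z : geomPoints (W.baseChange K)}
    (h : IsHeegnerNormPoint N W K κ Dt β jbar n c z) :
    IsHeegnerNormPoint N W K κ Dt' β jbar n c (m • z) := by
  obtain ⟨x, R, hx, hfix, hRsub, htrans, rfl⟩ := h
  refine ⟨m • x, R, hx.zsmul m hφ, fun σ hσ ↦ ?_, hRsub, htrans, ?_⟩
  · rw [smul_zsmul_geomPoints, hfix σ hσ]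
  · rw [Finset.smul_sum]
    exact Finset.sum_congr rfl fun r _ ↦ (smul_zsmul_geomPoints (W := W.baseChange K) (n := m) r x).symm

namespace HeegnerFamily

/-- **The rescaled Heegner family `m • F`** along a datum `Dt'` with `Dt'.φ = m • F.Dt.φ`: same
orientation `β`, basic point `m • y_K`, norm points `m • z_j`. (Print fixes one parametrisation; the
tree's `ModularParametrizationData` contains `[m] ∘ φ` with every `φ` — this is the family the
`∀ F` quantifier of the Heegner-point-main-conjecture binders also ranges over.) [cite: Howard2004HeegnerKolyvagin, §3.3 (the family `y_K, z_0, z_1, …`)] -/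
def zsmul (F : HeegnerFamily N W K κ jbar) (Dt' : ModularParametrizationData W N) (m : ℤ)
    (hφ : ∀ τ, Dt'.φ τ = m • F.Dt.φ τ) : HeegnerFamily N W K κ jbar where
  Dt := Dt'
  β := F.β
  dvd_sq_sub := F.dvd_sq_sub
  y := m • F.y
  isHeegnerNormPoint_y := F.isHeegnerNormPoint_y.zsmul m hφ
  z := fun j ↦ m • F.z j
  isHeegnerNormPoint_z := fun j ↦ (F.isHeegnerNormPoint_z j).zsmul m hφ

/-- The norm points of the rescaled family (unfolding). [cite: Howard2004HeegnerKolyvagin, §3.3] -/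
@[simp]
theorem zsmul_z (F : HeegnerFamily N W K κ jbar) (Dt' : ModularParametrizationData W N) (m : ℤ)
    (hφ : ∀ τ, Dt'.φ τ = m • F.Dt.φ τ) (j : ℕ) : (F.zsmul Dt' m hφ).z j = m • F.z j :=
  rfl

end HeegnerFamily

/-! ## §3 The `Λ`-adic Heegner class of the rescaled family is `(C m) • z` -/

namespace Castella2024

variable {γ : Field.absoluteGaloisGroup K}

/-- **`𝐳_∞(m • F) = m · 𝐳_∞(F)`**: if `z ∈ 𝔖_p` is the `Λ`-adic Heegner class of `F` with sign `α`,
then `(C m) • z` is the `Λ`-adic Heegner class of the rescaled family (Kummer families are additive;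
the constant `m` acts as `m •` levelwise). [cite: BertoliniDarmon1996, §2.5 eq. (7)–(8), Prop. 2.7 (the classes are Kummer images of the regularized points)] -/
theorem IsLambdaAdicHeegnerClass.zsmul [W.IsElliptic] {D : (W.baseChange K).LambdaAdicSelmerData κ γ}
    {F : HeegnerFamily N W K κ jbar} {α : ℤ} {z : D.S} (h : IsLambdaAdicHeegnerClass D F α z)
    (Dt' : ModularParametrizationData W N) (m : ℤ) (hφ : ∀ τ, Dt'.φ τ = m • F.Dt.φ τ) :
    IsLambdaAdicHeegnerClass D (F.zsmul Dt' m hφ) α ((PowerSeries.C (m : ℤ_[p]) : IwasawaAlgebra p) • z) := by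
  intro n k Q hQ
  have hfix : ∀ σ ∈ κ.layerSubgroup n, σ • F.z n = F.z n := fun σ hσ ↦
    (F.isHeegnerNormPoint_z n).smul_eq_self hσ
  obtain ⟨d₀, hd₀⟩ := (W.baseChange K).exists_isKummerFamilyOver p (κ.layerSubgroup n) (F.z n) hfix
  -- `D.proj n z = α^{n+1} • d₀` (the defining property, at a root of every level)
  have hd : D.proj n z = (α ^ (n + 1)) • d₀ := by
    funext k'
    have hpk : ((p : ℤ) ^ k') ≠ 0 := pow_ne_zero _ (Int.natCast_ne_zero.mpr (Fact.out : p.Prime).ne_zero)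
    obtain ⟨Q₀, hQ₀⟩ := (W.baseChange K).zsmul_geomPoints_surjective_holds hpk (F.z n)
    rw [h n k' Q₀ hQ₀, Pi.smul_apply, hd₀ k' Q₀ hQ₀]
  -- `m • d₀` is the Kummer family of `m • F.z n = (F.zsmul …).z n`
  have hmd₀ := hd₀.zsmul m
  rw [D.proj_C, padicPi_intCast, Pi.smul_apply, hd, Pi.smul_apply, smul_comm m (α ^ (n + 1)) (d₀ k),
    ← Pi.smul_apply m d₀ k, hmd₀ k Q hQ]

end Castella2024

/-! ## §4 Two pieces of `Λ`-module algebra -/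

namespace Module

variable {p : ℕ} [Fact p.Prime]

/-- **`char(S/Λ(a • z)) = (a) · char(S/Λz)`** for `S` finitely generated over `Λ`, `z` torsion-free,
`S/Λz` torsion and `a ≠ 0`: multiplicativity of the characteristic ideal along
`0 → Λ/(a) → S/Λ(a z) → S/Λz → 0` (`a̅ ↦ a̅ z`), with `char(Λ/(a)) = (a)`.
[cite: NeukirchSchmidtWingberg2008, Ch. V §3, Remark 2 after (5.3.9) (multiplicativity)] [cite: Washington1997, §13.2 (char of Λ/(f) is (f))] -/
theorem charIdeal_quotient_span_smul_eq {S : Type*} [AddCommGroup S]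
    [_root_.Module (IwasawaAlgebra p) S] [Module.Finite (IwasawaAlgebra p) S] {z : S}
    (hfree : ∀ a : IwasawaAlgebra p, a • z = 0 → a = 0)
    (htors : Module.IsTorsion (IwasawaAlgebra p) (S ⧸ Submodule.span (IwasawaAlgebra p) {z}))
    {a : IwasawaAlgebra p} (ha : a ≠ 0) :
    charIdeal (IwasawaAlgebra p) (S ⧸ Submodule.span (IwasawaAlgebra p) {a • z}) =
      Ideal.span {a} * charIdeal (IwasawaAlgebra p) (S ⧸ Submodule.span (IwasawaAlgebra p) {z}) := by
  set Pz := Submodule.span (IwasawaAlgebra p) {z} with hPz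
  set Paz := Submodule.span (IwasawaAlgebra p) {a • z} with hPaz
  have hle : Paz ≤ Pz := by
    rw [hPaz, Submodule.span_singleton_le_iff_mem]
    exact Submodule.smul_mem _ a (Submodule.mem_span_singleton_self z)
  -- `f : (IwasawaAlgebra p)/(a) → S/(IwasawaAlgebra p)(a z)`, `b̅ ↦ b̅ • z`
  let φ₀ : (IwasawaAlgebra p) →ₗ[(IwasawaAlgebra p)] S ⧸ Paz := Paz.mkQ.comp (LinearMap.toSpanSingleton (IwasawaAlgebra p) S z)
  have hφ₀ : ∀ b : (IwasawaAlgebra p), φ₀ b = Submodule.Quotient.mk (b • z) := fun b ↦ rfl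
  have hker : LinearMap.ker φ₀ = Ideal.span {a} := by
    ext b
    rw [LinearMap.mem_ker, hφ₀, Submodule.Quotient.mk_eq_zero, hPaz, Submodule.mem_span_singleton,
      Ideal.mem_span_singleton']
    constructor
    · rintro ⟨c, hc⟩
      refine ⟨c, ?_⟩
      have h0 : (c * a - b) • z = 0 := by rw [sub_smul, mul_smul, hc, sub_self]
      exact sub_eq_zero.mp (hfree _ h0)
    · rintro ⟨c, rfl⟩
      exact ⟨c, by rw [mul_smul]⟩
  let f : ((IwasawaAlgebra p) ⧸ Ideal.span {a}) →ₗ[(IwasawaAlgebra p)] S ⧸ Paz := (Ideal.span {a}).liftQ φ₀ hker.ge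
  have hf : Function.Injective f := by
    rw [← LinearMap.ker_eq_bot]
    exact Submodule.ker_liftQ_eq_bot _ _ _ hker.le
  let g : (S ⧸ Paz) →ₗ[(IwasawaAlgebra p)] S ⧸ Pz := Submodule.factor hle
  have hg : Function.Surjective g := by
    intro y
    obtain ⟨s, rfl⟩ := Submodule.Quotient.mk_surjective _ y
    exact ⟨Submodule.Quotient.mk s, rfl⟩
  have hfg : Function.Exact f g := by
    intro y
    obtain ⟨s, rfl⟩ := Submodule.Quotient.mk_surjective _ y
    rw [show g (Submodule.Quotient.mk s) = (Submodule.Quotient.mk s : S ⧸ Pz) from rfl,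
      Submodule.Quotient.mk_eq_zero, hPz, Submodule.mem_span_singleton]
    constructor
    · rintro ⟨b, hb⟩
      refine ⟨Submodule.Quotient.mk b, ?_⟩
      rw [show f (Submodule.Quotient.mk b) = φ₀ b from rfl, hφ₀, hb]
    · rintro ⟨w, hw⟩
      obtain ⟨b, rfl⟩ := Submodule.Quotient.mk_surjective _ w
      have hb : φ₀ b = Submodule.Quotient.mk s := hw
      rw [hφ₀, Submodule.Quotient.eq, hPaz, Submodule.mem_span_singleton] at hb
      obtain ⟨c, hc⟩ := hb
      -- `c • (a • z) = b • z - s`, so `s = (b - c a) • z`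
      exact ⟨b - c * a, by rw [sub_smul, mul_smul, hc, sub_sub_cancel]⟩
  -- torsion of the middle term
  have htorsM : Module.IsTorsion (IwasawaAlgebra p) (S ⧸ Paz) := by
    intro x
    obtain ⟨⟨b, hb⟩, hbx⟩ := @htors (g x)
    have hgbx : g (b • x) = 0 := by rw [map_smul]; exact hbx
    obtain ⟨w, hw⟩ := (hfg (b • x)).mp hgbx
    refine ⟨⟨a * b, mul_mem_nonZeroDivisors.mpr ⟨mem_nonZeroDivisors_of_ne_zero ha, hb⟩⟩, ?_⟩
    change (a * b) • x = 0
    rw [mul_smul, ← hw, ← map_smul]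
    obtain ⟨w₀, rfl⟩ := Submodule.Quotient.mk_surjective _ w
    rw [← Submodule.Quotient.mk_smul, (Submodule.Quotient.mk_eq_zero _).mpr
      (Ideal.mem_span_singleton'.mpr ⟨w₀, by rw [smul_eq_mul, mul_comm]⟩), map_zero]
  haveI : Module.Finite (IwasawaAlgebra p) (S ⧸ Paz) := inferInstance
  rw [charIdeal_eq_mul_of_exact htorsM f g hf hg hfg, charIdeal_quotient_span_singleton ha]

/-- **Nakayama**: in `Λ = ℤ_p⟦T⟧` (a local Noetherian domain) an ideal `I ≠ ⊥` cannot satisfy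
`I² = ((a)·I)²` for a non-unit `a`. [cite: Washington1997, §13.2 (Λ is a local Noetherian UFD)] -/
theorem false_of_sq_eq_span_mul_sq {I : Ideal (IwasawaAlgebra p)} (hI : I ≠ ⊥)
    {a : IwasawaAlgebra p} (ha : ¬ IsUnit a) (h : I ^ 2 = (Ideal.span {a} * I) ^ 2) : False := by
  have hJ : Ideal.span {a} ≤ IsLocalRing.maximalIdeal (IwasawaAlgebra p) := by
    rw [Ideal.span_le, Set.singleton_subset_iff]
    exact (IsLocalRing.mem_maximalIdeal a).mpr ha
  have hN : I ^ 2 ≤ (Ideal.span {a}) ^ 2 • I ^ 2 := by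
    rw [Ideal.smul_eq_mul, ← mul_pow, ← h]
  have hjac : (Ideal.span {a}) ^ 2 ≤ Ideal.jacobson ⊥ := by
    rw [IsLocalRing.jacobson_eq_maximalIdeal ⊥ bot_ne_top]
    exact (Ideal.pow_le_self two_ne_zero).trans hJ
  have h0 : I ^ 2 = ⊥ :=
    Submodule.eq_bot_of_le_smul_of_le_jacobson_bot _ _ (IsNoetherian.noetherian _) hN hjac
  rw [sq] at h0
  exact (Ideal.mul_eq_bot.mp h0).elim hI hI

end Module

/-! ## §5 The consequence for the Keller–Yin Thm 5.2.1 binder, by name -/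

namespace KellerYin2024

variable (N : ℕ) [NeZero N] (W : WeierstrassCurve ℚ) (K : Type u) [Field K] [NumberField K]
  (p : ℕ) [Fact p.Prime] (κ : ZpExtension K p) (γ : Field.absoluteGaloisGroup K)
  (jbar : AlgebraicClosure K →+* ℂ)

variable {N W K p κ γ jbar}

/-- **The typed Thm 5.2.1 (non-split clause) equates the Heegner sides of a family and of its
`m`-rescaling**: `char(𝔖/Λz)² = char(𝔖/Λ(C m • z))²` for the `Λ`-adic Heegner class `z` of `F` and
any rescaling datum `Dt'` (both sides equal `char(𝒳_tors)` by the binder). CONDITIONAL on the OPEN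
fact, which is here the point. [claim: KellerYin2024, status: under-review] -/
theorem charIdealSq_eq_of_thm521_OPEN_zsmul
    (h : thm521_multHg_charIdeal_torsion_eq_sq_OPEN N W K p κ γ jbar)
    (hyp : Thm521Hypotheses N W K p κ γ) (hns : ¬ W.HasSplitMultiplicativeReductionAtPrime p)
    (D : (W.baseChange K).LambdaAdicSelmerData κ γ) (X : (W.baseChange K).SelmerDualData κ γ)
    (F : HeegnerFamily N W K κ jbar) (Dt' : ModularParametrizationData W N) (m : ℤ)
    (hφ : ∀ τ, Dt'.φ τ = m • F.Dt.φ τ) {z : D.S} (hz : IsLambdaAdicHeegnerClass D F (-1) z) :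
    Module.charIdeal (IwasawaAlgebra p) (D.S ⧸ Submodule.span (IwasawaAlgebra p) {z}) ^ 2 =
      Module.charIdeal (IwasawaAlgebra p)
        (D.S ⧸ Submodule.span (IwasawaAlgebra p)
          {(PowerSeries.C (m : ℤ_[p]) : IwasawaAlgebra p) • z}) ^ 2 := by
  haveI : W.IsElliptic := hyp.isElliptic
  exact (charIdeal_torsion_eq_sq_of_thm521_OPEN_of_not_split h hyp hns D F X hz).symm.trans
    (charIdeal_torsion_eq_sq_of_thm521_OPEN_of_not_split h hyp hns D (F.zsmul Dt' m hφ) X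
      (hz.zsmul Dt' m hφ))

/-- **The typed `∀ F` integral equality refutes itself on one non-degenerate rescalable witness.**
From `thm521_…_OPEN` at a non-split multiplicative Eisenstein `p`, a Heegner family `F` with a
torsion-free `Λ`-adic Heegner class `z` such that `𝔖/Λz` is `Λ`-torsion (print: "`𝔖` has `Λ`-rank one"
and `𝐳_∞` non-torsion), and a datum `Dt'` rescaling `F`'s parametrisation by `[p]`: `False` — because
the class of `F.zsmul Dt' p` is `p • z`, `char(𝔖/Λpz) = (p)·char(𝔖/Λz)`, and `I² = (p)²I²` is impossible
for `I = char(𝔖/Λz) ≠ ⊥` in the local ring `Λ`. Print's statement (ONE fixed parametrisation) is not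
refuted; the LAYOUT `∀ (F : HeegnerFamily …)` over a non-rigid parametrisation datum is.
[claim: KellerYin2024, status: under-review]
[cite: CastellaGrossiLeeSkinner2022, Remark after Conj. A (Intro; TeX L281–283: the integral terms are not isogeny-invariant)] -/
theorem false_of_thm521_OPEN_zsmul
    (h : thm521_multHg_charIdeal_torsion_eq_sq_OPEN N W K p κ γ jbar)
    (hyp : Thm521Hypotheses N W K p κ γ) (hns : ¬ W.HasSplitMultiplicativeReductionAtPrime p)
    (D : (W.baseChange K).LambdaAdicSelmerData κ γ) (X : (W.baseChange K).SelmerDualData κ γ)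
    (F : HeegnerFamily N W K κ jbar) (Dt' : ModularParametrizationData W N)
    (hφ : ∀ τ, Dt'.φ τ = (p : ℤ) • F.Dt.φ τ) {z : D.S} (hz : IsLambdaAdicHeegnerClass D F (-1) z)
    (htors : Module.IsTorsion (IwasawaAlgebra p) (D.S ⧸ Submodule.span (IwasawaAlgebra p) {z}))
    (hfree : ∀ a : IwasawaAlgebra p, a • z = 0 → a = 0) : False := by
  haveI : Module.Finite (IwasawaAlgebra p) D.S := ((h hyp D F X).1).1
  have hprime : Prime (PowerSeries.C ((p : ℤ) : ℤ_[p]) : IwasawaAlgebra p) := by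
    rw [Int.cast_natCast]
    exact IwasawaAlgebra.prime_C p
  have hsq := charIdealSq_eq_of_thm521_OPEN_zsmul h hyp hns D X F Dt' (p : ℤ) hφ hz
  rw [Module.charIdeal_quotient_span_smul_eq hfree htors hprime.ne_zero] at hsq
  exact Module.false_of_sq_eq_span_mul_sq
    (Literature.NumberTheory.EllipticCurves.Module.charIdeal_ne_bot (IwasawaAlgebra p) _)
    hprime.not_unit hsq

end KellerYin2024

/-! ## §6 The same consequence for the Castella 2024 Thm 1.3 binder (identical layout), by name -/

namespace Castella2024

variable {N : ℕ} [NeZero N] {W : WeierstrassCurve ℚ} [W.IsGloballyMinimal] {K : Type u} [Field K]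
  [NumberField K] {p : ℕ} [Fact p.Prime] {κ : ZpExtension K p} {γ : Field.absoluteGaloisGroup K}
  {jbar : AlgebraicClosure K →+* ℂ}

/-- **The typed Castella Thm 1.3 (non-split clause) equates the Heegner sides of a family and of its
`m`-rescaling** (both equal `char(X_tors)` by the binder). CONDITIONAL on the OPEN fact.
[claim: Castella2024, status: under-review] -/
theorem charIdealSq_eq_of_thm13_OPEN_zsmul
    (h : thm13_charIdeal_torsion_eq_sq_OPEN N W K p κ γ jbar)
    (hyp : Thm13Hypotheses N W K p κ γ) (hns : ¬ W.HasSplitMultiplicativeReductionAtPrime p)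
    (D : (W.baseChange K).LambdaAdicSelmerData κ γ) (X : (W.baseChange K).SelmerDualData κ γ)
    (F : HeegnerFamily N W K κ jbar) (Dt' : ModularParametrizationData W N) (m : ℤ)
    (hφ : ∀ τ, Dt'.φ τ = m • F.Dt.φ τ) {z : D.S} (hz : IsLambdaAdicHeegnerClass D F (-1) z) :
    Module.charIdeal (IwasawaAlgebra p) (D.S ⧸ Submodule.span (IwasawaAlgebra p) {z}) ^ 2 =
      Module.charIdeal (IwasawaAlgebra p)
        (D.S ⧸ Submodule.span (IwasawaAlgebra p)
          {(PowerSeries.C (m : ℤ_[p]) : IwasawaAlgebra p) • z}) ^ 2 := by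
  haveI : W.IsElliptic := hyp.isElliptic
  exact (charIdeal_torsion_eq_sq_of_thm13_OPEN_of_not_split h hyp hns D F X hz).symm.trans
    (charIdeal_torsion_eq_sq_of_thm13_OPEN_of_not_split h hyp hns D (F.zsmul Dt' m hφ) X
      (hz.zsmul Dt' m hφ))

/-- **The typed `∀ F` integral equality of Castella Thm 1.3 refutes itself on one non-degenerate
rescalable witness** (same two lines as `KellerYin2024.false_of_thm521_OPEN_zsmul`; print fixes one
parametrisation, l.268, and is not refuted). [claim: Castella2024, status: under-review]
[cite: CastellaGrossiLeeSkinner2022, Remark after Conj. A (Intro; TeX L281–283: the integral terms are not isogeny-invariant)] -/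
theorem false_of_thm13_OPEN_zsmul
    (h : thm13_charIdeal_torsion_eq_sq_OPEN N W K p κ γ jbar)
    (hyp : Thm13Hypotheses N W K p κ γ) (hns : ¬ W.HasSplitMultiplicativeReductionAtPrime p)
    (D : (W.baseChange K).LambdaAdicSelmerData κ γ) (X : (W.baseChange K).SelmerDualData κ γ)
    (F : HeegnerFamily N W K κ jbar) (Dt' : ModularParametrizationData W N)
    (hφ : ∀ τ, Dt'.φ τ = (p : ℤ) • F.Dt.φ τ) {z : D.S} (hz : IsLambdaAdicHeegnerClass D F (-1) z)
    (htors : Module.IsTorsion (IwasawaAlgebra p) (D.S ⧸ Submodule.span (IwasawaAlgebra p) {z}))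
    (hfree : ∀ a : IwasawaAlgebra p, a • z = 0 → a = 0) : False := by
  haveI : Module.Finite (IwasawaAlgebra p) D.S := ((h hyp D F X).1).1
  have hprime : Prime (PowerSeries.C ((p : ℤ) : ℤ_[p]) : IwasawaAlgebra p) := by
    rw [Int.cast_natCast]
    exact IwasawaAlgebra.prime_C p
  have hsq := charIdealSq_eq_of_thm13_OPEN_zsmul h hyp hns D X F Dt' (p : ℤ) hφ hz
  rw [Module.charIdeal_quotient_span_smul_eq hfree htors hprime.ne_zero] at hsq
  exact Module.false_of_sq_eq_span_mul_sq
    (Literature.NumberTheory.EllipticCurves.Module.charIdeal_ne_bot (IwasawaAlgebra p) _)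
    hprime.not_unit hsq

end Castella2024

end Literature.NumberTheory.EllipticCurves

end
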